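import Summits.NavierStokesRegularity.FunctionalMining.GradientTransport
import Summits.NavierStokesRegularity.FunctionalMining.StrainMoment
import Literature.Analysis.FunctionSpaces.TorusSpaceTimeComposition
import HarnessLib

/-!
# FunctionalMining — the strain magnitude `|S|²` along classical solutions: smoothness and `∂ₜ|S|²`

Search for candidate a priori estimates; no regularity claim. Cell `pub-nsfunc`, prove seat
(gen 9). Infrastructure toward the K0 rows `ES.absS.q|T_LD|G1` (SIEVELD §3.3: strain equation
`∂ₜS + (u·∇)S = −S² − ¼(ω⊗ω − |ω|²I) − Π + νΔS`). With the strain entries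
`Sᵢⱼ = ((∂ⱼu)ᵢ + (∂ᵢu)ⱼ)/2` and `|S|² = ∑ᵢⱼ Sᵢⱼ²` (`torusStrainSqAt`, `StrainMoment.lean`), this file
records, along a classical solution of `∂ₜu + (u·∇)u = νΔu − ∇p + f`, `div u = 0` on
`T^d × [a, b]`:

* space and space–time smoothness of `Sᵢⱼ` and `|S|²`;
* the one-sided time derivative of `s ↦ |S(u(s))(x)|²` within `[a, b]`:
  `∂ₜ|S|² = 2 ∑ᵢⱼ Sᵢⱼ · (∂ᵢA)ⱼ`, `A = ∂ₜu` (symmetry of `S`), and, through the velocity-gradient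
  transport identity (`GradientTensor.timeDerivWithin_partialDeriv_apply`, Majda–Bertozzi (1.29)),
  `∂ₜ|S|² = 2ν∑SᵢⱼΔ(∂ᵢu)ⱼ − 2∑Sᵢⱼ∂ᵢ∂ⱼp + 2∑Sᵢⱼ(∂ᵢf)ⱼ − 2∑Sᵢⱼ(∂ᵢu)ₖ(∂ₖu)ⱼ − ∑ₖuₖ∂ₖ|S|²`.

## Main statements

* `isSmooth_strainEntry`, `isSmooth_strainSqAt`, `isSmoothSpaceTimeOn_strainSqAt`.
* `sum_strain_mul_eq_sum_strain_mul_symm` — `∑ᵢⱼSᵢⱼMⱼᵢ = ∑ᵢⱼSᵢⱼMᵢⱼ`.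
* `partialDeriv_strainSqAt` — `∂ₖ|S|² = 2∑ᵢⱼ Sᵢⱼ ∂ₖ(∂ᵢu)ⱼ`.
* `hasDerivWithinAt_strainSqAt` — `∂ₜ|S|² = 2∑ᵢⱼ Sᵢⱼ (∂ᵢ∂ₜu)ⱼ`.
* `timeDerivWithin_strainSqAt` — the same with the momentum equation substituted.
-/

noncomputable section

open MeasureTheory Finset Set
open scoped InnerProductSpace RealInnerProductSpace ContDiff

namespace Summit.NavierStokesRegularity.FunctionalMining

open Literature.Analysis.FunctionSpaces Literature.Analysis.FluidPDE

namespace GradientTensor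

variable {d : Type*} [Fintype d] [DecidableEq d]

/-! ## 1. Smoothness -/

/-- The strain entries `x ↦ Sᵢⱼ(x) = ((∂ⱼv)ᵢ + (∂ᵢv)ⱼ)/2` of a smooth field are smooth. [folklore] -/
theorem isSmooth_strainEntry {v : UnitAddTorus d → EuclideanSpace ℝ d} (hv : Torus.IsSmooth v)
    (i j : d) :
    Torus.IsSmooth (fun x => (Torus.partialDeriv j v x i + Torus.partialDeriv i v x j) / 2) :=
  ContDiff.div_const (((hv.partialDeriv j).apply i).add ((hv.partialDeriv i).apply j)) 2

/-- `x ↦ |S(x)|²` is smooth for smooth `v`. [folklore] -/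
theorem isSmooth_strainSqAt {v : UnitAddTorus d → EuclideanSpace ℝ d} (hv : Torus.IsSmooth v) :
    Torus.IsSmooth (torusStrainSqAt v) := by
  have h : Torus.IsSmooth (fun x => ∑ i, ∑ j,
      ((Torus.partialDeriv j v x i + Torus.partialDeriv i v x j) / 2) ^ 2) :=
    ContDiff.sum fun i _ => ContDiff.sum fun j _ => (isSmooth_strainEntry hv i j).pow 2
  exact h

/-- Space–time smoothness of the strain entries along a jointly smooth velocity. [folklore] -/
theorem isSmoothSpaceTimeOn_strainEntry {S : Set ℝ} {u : ℝ → UnitAddTorus d → EuclideanSpace ℝ d}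
    (hu : Torus.IsSmoothSpaceTimeOn S u) (hS : UniqueDiffOn ℝ S) (i j : d) :
    Torus.IsSmoothSpaceTimeOn S
      (fun s y => (Torus.partialDeriv j (u s) y i + Torus.partialDeriv i (u s) y j) / 2) := by
  have h : Torus.IsSmoothSpaceTimeOn S
      (fun s y => 2⁻¹ * (Torus.partialDeriv j (u s) y i + Torus.partialDeriv i (u s) y j)) :=
    ContDiffOn.mul contDiffOn_const (((hu.partialDeriv hS j).apply i).add ((hu.partialDeriv hS i).apply j))
  refine ContDiffOn.congr h fun z _ => ?_
  show (Torus.partialDeriv j (u z.1) (Torus.proj z.2) i + Torus.partialDeriv i (u z.1) (Torus.proj z.2) j) / 2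
    = 2⁻¹ * (Torus.partialDeriv j (u z.1) (Torus.proj z.2) i + Torus.partialDeriv i (u z.1) (Torus.proj z.2) j)
  ring

/-- Space–time smoothness of `|S|²` along a jointly smooth velocity. [folklore] -/
theorem isSmoothSpaceTimeOn_strainSqAt {S : Set ℝ} {u : ℝ → UnitAddTorus d → EuclideanSpace ℝ d}
    (hu : Torus.IsSmoothSpaceTimeOn S u) (hS : UniqueDiffOn ℝ S) :
    Torus.IsSmoothSpaceTimeOn S (fun s y => torusStrainSqAt (u s) y) := by
  have h : Torus.IsSmoothSpaceTimeOn S (fun s y => ∑ i, ∑ j,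
      ((Torus.partialDeriv j (u s) y i + Torus.partialDeriv i (u s) y j) / 2) ^ 2) :=
    Torus.IsSmoothSpaceTimeOn.sum fun i _ => Torus.IsSmoothSpaceTimeOn.sum fun j _ =>
      ContDiffOn.pow (isSmoothSpaceTimeOn_strainEntry hu hS i j) 2
  exact h

/-! ## 2. Pointwise algebra -/

omit [DecidableEq d] in
/-- Symmetrisation under a symmetric weight: if `Sᵢⱼ = Sⱼᵢ` then `∑ᵢⱼ Sᵢⱼ Mⱼᵢ = ∑ᵢⱼ Sᵢⱼ Mᵢⱼ`.
[folklore] -/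
theorem sum_symm_mul_swap (T M : d → d → ℝ) (hT : ∀ i j, T i j = T j i) :
    ∑ i, ∑ j, T i j * M j i = ∑ i, ∑ j, T i j * M i j := by
  rw [Finset.sum_comm]
  exact Finset.sum_congr rfl fun i _ => Finset.sum_congr rfl fun j _ => by rw [hT j i]

omit [DecidableEq d] in
/-- For a symmetric `T`: `∑ᵢⱼ 2 Tᵢⱼ (Mⱼᵢ + Mᵢⱼ)/2 = 2 ∑ᵢⱼ Tᵢⱼ Mᵢⱼ`. [folklore] -/
theorem sum_symm_mul_symmPair (T M : d → d → ℝ) (hT : ∀ i j, T i j = T j i) :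
    ∑ i, ∑ j, 2 * T i j * ((M j i + M i j) / 2) = 2 * ∑ i, ∑ j, T i j * M i j := by
  have e : ∀ i j, 2 * T i j * ((M j i + M i j) / 2) = T i j * M j i + T i j * M i j :=
    fun i j => by ring
  simp_rw [e, Finset.sum_add_distrib]
  rw [sum_symm_mul_swap T M hT]
  ring

/-- `∂ₖSᵢⱼ = (∂ₖ(∂ⱼv)ᵢ + ∂ₖ(∂ᵢv)ⱼ)/2` for smooth `v`. [folklore] -/
theorem partialDeriv_strainEntry {v : UnitAddTorus d → EuclideanSpace ℝ d} (hv : Torus.IsSmooth v)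
    (i j k : d) (x : UnitAddTorus d) :
    Torus.partialDeriv k (fun y => (Torus.partialDeriv j v y i + Torus.partialDeriv i v y j) / 2) x =
      (Torus.partialDeriv k (Torus.partialDeriv j v) x i +
        Torus.partialDeriv k (Torus.partialDeriv i v) x j) / 2 := by
  have hj : Torus.IsContDiff 1 (fun y => Torus.partialDeriv j v y i) :=
    ((hv.partialDeriv j).apply i).isContDiff (by simp)
  have hi : Torus.IsContDiff 1 (fun y => Torus.partialDeriv i v y j) :=
    ((hv.partialDeriv i).apply j).isContDiff (by simp)
  have hfun : (fun y => (Torus.partialDeriv j v y i + Torus.partialDeriv i v y j) / 2) =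
      (2⁻¹ : ℝ) • ((fun y => Torus.partialDeriv j v y i) + fun y => Torus.partialDeriv i v y j) := by
    funext y; simp only [Pi.smul_apply, Pi.add_apply, smul_eq_mul]; ring
  rw [hfun, Torus.partialDeriv_const_smul (hj.add hi) _ k, Pi.smul_apply,
    Torus.partialDeriv_add hj hi k, Pi.add_apply,
    Torus.partialDeriv_apply_coord ((hv.partialDeriv j).isContDiff (by simp)),
    Torus.partialDeriv_apply_coord ((hv.partialDeriv i).isContDiff (by simp)), smul_eq_mul]
  ring

/-- **`∂ₖ|S|² = 2∑ᵢⱼ Sᵢⱼ ∂ₖ(∂ᵢv)ⱼ`** for smooth `v` (chain rule and symmetry of `S`). [folklore] -/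
theorem partialDeriv_strainSqAt {v : UnitAddTorus d → EuclideanSpace ℝ d} (hv : Torus.IsSmooth v)
    (k : d) (x : UnitAddTorus d) :
    Torus.partialDeriv k (torusStrainSqAt v) x =
      2 * ∑ i, ∑ j, (Torus.partialDeriv j v x i + Torus.partialDeriv i v x j) / 2 *
        Torus.partialDeriv k (Torus.partialDeriv i v) x j := by
  have hS1 : ∀ i j, Torus.IsContDiff 1
      (fun y => (Torus.partialDeriv j v y i + Torus.partialDeriv i v y j) / 2) :=
    fun i j => (isSmooth_strainEntry hv i j).isContDiff (by simp)
  have hsq : ∀ i j, Torus.IsContDiff 1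
      (fun y => ((Torus.partialDeriv j v y i + Torus.partialDeriv i v y j) / 2) ^ 2) :=
    fun i j => (show Torus.IsSmooth
      (fun y => ((Torus.partialDeriv j v y i + Torus.partialDeriv i v y j) / 2) ^ 2) from
        (isSmooth_strainEntry hv i j).pow 2).isContDiff (by simp)
  have hrow : ∀ i, Torus.IsContDiff 1 (fun y => ∑ j,
      ((Torus.partialDeriv j v y i + Torus.partialDeriv i v y j) / 2) ^ 2) :=
    fun i => ContDiff.sum fun j _ => hsq i j
  have hfun : torusStrainSqAt v = fun y => ∑ i, ∑ j,
      ((Torus.partialDeriv j v y i + Torus.partialDeriv i v y j) / 2) ^ 2 := rfl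
  rw [hfun, Torus.partialDeriv_finset_sum Finset.univ (fun i _ => hrow i) k x]
  have hinner : ∀ i, Torus.partialDeriv k (fun y => ∑ j,
      ((Torus.partialDeriv j v y i + Torus.partialDeriv i v y j) / 2) ^ 2) x =
      ∑ j, Torus.partialDeriv k
        (fun y => ((Torus.partialDeriv j v y i + Torus.partialDeriv i v y j) / 2) ^ 2) x :=
    fun i => Torus.partialDeriv_finset_sum Finset.univ (fun j _ => hsq i j) k x
  simp_rw [hinner]
  have hpow : ∀ i j, Torus.partialDeriv k
      (fun y => ((Torus.partialDeriv j v y i + Torus.partialDeriv i v y j) / 2) ^ 2) x =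
      2 * ((Torus.partialDeriv j v x i + Torus.partialDeriv i v x j) / 2) *
        ((Torus.partialDeriv k (Torus.partialDeriv j v) x i +
          Torus.partialDeriv k (Torus.partialDeriv i v) x j) / 2) := by
    intro i j
    have e : (fun y => ((Torus.partialDeriv j v y i + Torus.partialDeriv i v y j) / 2) ^ 2) =
        fun y => ((Torus.partialDeriv j v y i + Torus.partialDeriv i v y j) / 2) *
          ((Torus.partialDeriv j v y i + Torus.partialDeriv i v y j) / 2) := by
      funext y; ring
    rw [e, Torus.partialDeriv_mul (hS1 i j) (hS1 i j) k x, partialDeriv_strainEntry hv]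
    ring
  simp_rw [hpow]
  exact sum_symm_mul_symmPair
    (fun i j => (Torus.partialDeriv j v x i + Torus.partialDeriv i v x j) / 2)
    (fun i j => Torus.partialDeriv k (Torus.partialDeriv i v) x j) (fun i j => by ring)

/-! ## 3. The time derivative of `|S|²` -/

/-- **`∂ₜ|S|² = 2∑ᵢⱼ Sᵢⱼ (∂ᵢA)ⱼ`, `A = ∂ₜu`** along a classical solution (chain rule on the strain
entries, `GradientTensor.hasDerivWithinAt_partialDeriv_apply`, and symmetry of `S`). [folklore] -/
theorem hasDerivWithinAt_strainSqAt
    {a b ν : ℝ} {f u : ℝ → UnitAddTorus d → EuclideanSpace ℝ d} {p : ℝ → UnitAddTorus d → ℝ}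
    (h : Torus.IsClassicalNSSolutionOn (Icc a b) ν f u p) (hab : a < b) {t : ℝ}
    (ht : t ∈ Icc a b) (x : UnitAddTorus d) :
    HasDerivWithinAt (fun s => torusStrainSqAt (u s) x)
      (2 * ∑ i, ∑ j, (Torus.partialDeriv j (u t) x i + Torus.partialDeriv i (u t) x j) / 2 *
        Torus.partialDeriv i (Torus.timeDerivWithin (Icc a b) u t) x j) (Icc a b) t := by
  set A : UnitAddTorus d → EuclideanSpace ℝ d := Torus.timeDerivWithin (Icc a b) u t with hA
  have hD : ∀ i j, HasDerivWithinAt (fun s => Torus.partialDeriv i (u s) x j)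
      (Torus.partialDeriv i A x j) (Icc a b) t :=
    fun i j => hasDerivWithinAt_partialDeriv_apply h hab ht i j x
  have hE : ∀ i j, HasDerivWithinAt
      (fun s => ((Torus.partialDeriv j (u s) x i + Torus.partialDeriv i (u s) x j) / 2) ^ 2)
      (2 * ((Torus.partialDeriv j (u t) x i + Torus.partialDeriv i (u t) x j) / 2) *
        ((Torus.partialDeriv j A x i + Torus.partialDeriv i A x j) / 2)) (Icc a b) t := by
    intro i j
    have h1 := ((hD j i).add (hD i j)).div_const 2
    convert h1.pow 2 using 1
    all_goals first | rfl | norm_num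
  have hsum : HasDerivWithinAt (fun s => torusStrainSqAt (u s) x)
      (∑ i, ∑ j, 2 * ((Torus.partialDeriv j (u t) x i + Torus.partialDeriv i (u t) x j) / 2) *
        ((Torus.partialDeriv j A x i + Torus.partialDeriv i A x j) / 2)) (Icc a b) t := by
    have := HasDerivWithinAt.fun_sum (u := Finset.univ) fun i _ =>
      HasDerivWithinAt.fun_sum (u := Finset.univ) fun j _ => hE i j
    exact this
  refine hsum.congr_deriv ?_
  exact sum_symm_mul_symmPair
    (fun i j => (Torus.partialDeriv j (u t) x i + Torus.partialDeriv i (u t) x j) / 2)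
    (fun i j => Torus.partialDeriv i A x j) (fun i j => by ring)

/-- **`∂ₜ|S|²` with the momentum equation substituted** (Majda–Bertozzi (1.29) contracted with
`2S`): along a classical solution on `T^d × [a, b]`, at every `t ∈ [a, b]` and every `x`,
`∂ₜ|S|² = 2∑ᵢⱼ Sᵢⱼ (ν(∂ᵢΔu)ⱼ − ∂ᵢ∂ⱼp + (∂ᵢf)ⱼ − ∑ₖ(∂ᵢu)ₖ(∂ₖu)ⱼ − ∑ₖ uₖ∂ₖ(∂ᵢu)ⱼ)`.
[cite: MajdaBertozziCUP2002, §1.4 eq. (1.29)] -/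
theorem timeDerivWithin_strainSqAt
    {a b ν : ℝ} {f u : ℝ → UnitAddTorus d → EuclideanSpace ℝ d} {p : ℝ → UnitAddTorus d → ℝ}
    (h : Torus.IsClassicalNSSolutionOn (Icc a b) ν f u p) (hab : a < b) {t : ℝ}
    (ht : t ∈ Icc a b) (x : UnitAddTorus d) :
    Torus.timeDerivWithin (Icc a b) (fun s y => torusStrainSqAt (u s) y) t x =
      2 * ∑ i, ∑ j, (Torus.partialDeriv j (u t) x i + Torus.partialDeriv i (u t) x j) / 2 *
        (ν * Torus.partialDeriv i (Torus.laplacian (u t)) x j -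
          Torus.partialDeriv i (Torus.partialDeriv j (p t)) x +
          Torus.partialDeriv i (f t) x j -
          (∑ k, Torus.partialDeriv i (u t) x k * Torus.partialDeriv k (u t) x j) -
          ∑ k, u t x k * Torus.partialDeriv k (Torus.partialDeriv i (u t)) x j) := by
  have hU : UniqueDiffOn ℝ (Icc a b) := uniqueDiffOn_Icc hab
  rw [Torus.timeDerivWithin, (hasDerivWithinAt_strainSqAt h hab ht x).derivWithin (hU t ht)]
  congr 1
  refine Finset.sum_congr rfl fun i _ => Finset.sum_congr rfl fun j _ => ?_
  have e := timeDerivWithin_partialDeriv_apply h hab ht i j x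
  rw [Torus.timeDerivWithin, (hasDerivWithinAt_partialDeriv_apply h hab ht i j x).derivWithin (hU t ht)]
    at e
  rw [e]

end GradientTensor

end Summit.NavierStokesRegularity.FunctionalMining
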